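import Summits.QuantumFields.BalabanUV.T4Continuum.Support.NE3QuadRemainderGauged
import Summits.QuantumFields.BalabanUV.T4Continuum.Support.NE3GaugedTwoTierShape
import Summits.QuantumFields.BalabanUV.T4Continuum.Support.NE3LandauOrbit
import HarnessLib

/-!
# T⁴ programme, node NE3 — route Π, item Π-C-3γ″, file γ-END: THE QUADRATIC LETTER OF THE JUNCTION FROM THE GAUGED TWO-TIER LEAF —
# `GaugedTwoTier` ∧ Π-C's tower class ∧ the fibre ⟹ `‖dirIter L (j+1) W X₀ z κ‖ ≤ C^γ·(L^{j+1})²·(m² + ℓ² + (Λ∕L^{j+1})²)(z,κ)`,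
# MODULO the Coulomb-profile letter of the linearised k-fold average (γ4″, leaf-04-g8's `NE3LinearTowerProfile`), taken here as a displayed hypothesis

NE3 (node U1b) formalisation swarm `b2b-balaban-t4-ne3-formalise-*`, LEAF PROVER 02 (gen 8; Π-C authors' lineage); design D-ne3leaf02g8-1 §4 (Γ″).
INPUTS BY NAME: γ-top `NE3QuadRemainderGauged.norm_dirIter_sub_dirIter_defect_le_of_fibre` + `norm_gaugeDefect_le`; the leaf `NE3GaugedTwoTierShape.GaugedTwoTier`.
THE ONE HYPOTHESIS THAT IS NOT A LEAF: `hlin` = the profile letter of γ4″ at the bond `(z,κ)` — for every skew periodic `Y` dominated on the box of record by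
`σ + β·Σ_{c∈S′} prof (y − c)`: `‖dirIter L (j+1) W Y z κ‖ ≤ Aσ·L^{j+1}·σ + Bβ·|S′|·β`.  When leaf-04-g8's F-B lands, a corollary instantiates it by name.

THE ASSEMBLY.  With the leaf's gauge data `(λ, B)` and `Q := X₀ − gaugeDir W λ − B`: (1) γ-top on the fibre gives `‖D X₀ − D Q‖ ≤ C₂(Mm)² + 10240(2(3+12d)Mm(Λ₋+Λ₊) + Λ₋Λ₊)`
with the corner charges `Λ₋, Λ₊ ≤ ℓ + Λ·|S|` (`prof ≤ 1`); (2) on the box `‖Q(y,μ)‖ ≤ σ_Q + β_Q·Σ_{c∈S″} prof(y − c)`, `S″ := S ∪ ⋃_μ (S − e_μ)` (so that the far-end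
charge is profiled from the near end), `σ_Q = 10240(2mℓ + ℓ²)`, `β_Q = 10240·Λ·(2m + 2ℓ + Λ·|S″|)`; (3) `hlin` on `Q`; (4) every product is split into the leaf's
currencies `m`, `ℓ`, `Λ∕M` (AM–GM) — step (4) and the owner's 4γ currency (weight `m̂ := √(m² + ℓ² + (Λ∕M)²)`, square sum = the leaf's (T3)) are the sequel
file `NE3QuadRemainderGaugedLetter`; this file stops at the four-term bound for GIVEN gauge data `(λ, B)` (`GaugedTwoTierData`).

HONEST FRAMING.  Real bookkeeping over γ-top; `hlin` (γ4″) is a displayed HYPOTHESIS here; the leaf is asserted for no pair (zero datum only); Π-C-3γ″ is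
therefore NOT closed by this file alone; T-E_w♯ and NE3 are NOT proved; spine PROVED 0∕9; finite T⁴ rung (B)+1 — NOT infinite volume, NOT mass gap, NOT `BetaPertH`,
NOT Clay.  PLACEMENT: `Summits/QuantumFields/BalabanUV/`.  HONEST DEPENDENCY: continuum YM on T⁴ ⇐ BetaPertH ∧ nine spine estimates (0/9 proved); BetaPertH ⇐ (D1) ∧
(D4) ∧ CAP+tail; G-an2-4 gates asym, D1 and NE2/3/4.
-/

set_option autoImplicit false

open scoped BigOperators Matrix.Norms.L2Operator
open NormedSpace Finset

namespace Summit.QuantumFields.BalabanUV.T4Continuum.NE3QuadRemainderGaugedEnd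

open Literature.MathematicalPhysics.QuantumFieldTheory.Balaban1983to89
open B7Prop1Explicit B7Prop2Explicit MatrixLog
open B7Prop1Local (InBox loK bondHiK)
open T4AveragingDeficitWall (IsSkewDir IsUnitaryCfg SmallField vary)
open T4AveragingDeficitWallBoundary (IsPeriodicCfg)
open AveragingDeficitPeriodicCounting (IsPeriodicDir)
open AveragingDeficitMultiLevelPrep (cavgIter LevelSmall)
open BlockAverageVaryDisc (rho0 rho0_pos)
open BlockAveragePushDirGauge (gaugeDir expGauge isPeriodicDir_gaugeDir)
open BlockAverageCurrent (smallField_gaugeAct)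
open NE3TangentCovariantTower (dirIter)
open NE3LinearisedAverageSup (curvSum)
open NE3LandauOrbit (gaugeDir_skew)
open NE3QuadRemainderGaugeStep (expGauge_one_mem_unitaryUnits)
open NE3QuadRemainderGauged (norm_dirIter_sub_dirIter_defect_le_of_fibre norm_gaugeDefect_le)
open NE3SmoothLiftW (gaugeAct_inv_gaugeAct)
open NE3GaugedTwoTierShape (GaugedTwoTierData)

noncomputable section

variable {d : ℕ} {n : Type*} [Fintype n] [DecidableEq n] [Nonempty n]

/-! ## §1 Bookkeeping -/

omit [Fintype n] [DecidableEq n] [Nonempty n] in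
/-- The corners `L^k•z` and `L^k•(z+e_κ)` lie in the box of record of `(z,κ)` (`1 ≤ L`). [folklore] -/
theorem corner_inBox {L : ℕ} (hL : 1 ≤ L) (k : ℕ) (z : Site d) (κ : Fin d) :
    InBox (loK L k z) (bondHiK L k z κ) (((L : ℤ) ^ k) • z) ∧ InBox (loK L k z) (bondHiK L k z κ) (((L : ℤ) ^ k) • (z + e κ)) := by
  have hP : (1 : ℤ) ≤ (L : ℤ) ^ k := by exact_mod_cast Nat.one_le_pow k L hL
  refine ⟨fun i => ⟨?_, ?_⟩, fun i => ⟨?_, ?_⟩⟩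
  · simp only [loK, Pi.smul_apply, smul_eq_mul]; exact le_rfl
  · simp only [bondHiK, Pi.smul_apply, smul_eq_mul]
    by_cases h : i = κ
    · rw [if_pos h]; nlinarith
    · rw [if_neg h]; nlinarith
  · simp only [loK, Pi.smul_apply, smul_eq_mul, Pi.add_apply, e_apply]
    by_cases h : i = κ
    · rw [if_pos h]; nlinarith
    · rw [if_neg h]; nlinarith
  · simp only [bondHiK, Pi.smul_apply, smul_eq_mul, Pi.add_apply, e_apply]
    by_cases h : i = κ
    · rw [if_pos h, if_pos h]; nlinarith
    · rw [if_neg h, if_neg h]; nlinarith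

omit [Fintype n] [DecidableEq n] [Nonempty n] in
/-- A finite profile sum is at most the cardinality when the profile is `≤ 1`. [folklore] -/
theorem sum_prof_le_card {prof : Site d → ℝ} (h1 : ∀ v, prof v ≤ 1) (S : Finset (Site d)) (y : Site d) :
    ∑ c ∈ S, prof (y - c) ≤ S.card := by
  calc ∑ c ∈ S, prof (y - c) ≤ ∑ _c ∈ S, (1 : ℝ) := Finset.sum_le_sum fun c _ => h1 _
    _ = S.card := by simp

omit [Fintype n] [DecidableEq n] [Nonempty n] in
/-- THE SHIFTED CORNER SET `S″ := S ∪ ⋃_μ (S − e_μ)`: the far-end charge of a bond is profiled from its near end. [folklore] -/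
theorem sum_prof_shift_le {prof : Site d → ℝ} (h0 : ∀ v, 0 ≤ prof v) (S : Finset (Site d)) (y : Site d) (μ : Fin d) :
    ∑ c ∈ S, prof (y + e μ - c) ≤ ∑ c ∈ S ∪ S.biUnion (fun c => Finset.univ.image fun ν : Fin d => c - e ν), prof (y - c) := by
  classical
  have hinj : Set.InjOn (fun c : Site d => c - e μ) S := fun a _ b _ h => by simpa using h
  calc ∑ c ∈ S, prof (y + e μ - c) = ∑ c ∈ S.image (fun c => c - e μ), prof (y - c) := by
        rw [Finset.sum_image hinj]
        refine Finset.sum_congr rfl fun c _ => ?_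
        congr 1; abel
    _ ≤ _ := by
        refine Finset.sum_le_sum_of_subset_of_nonneg ?_ fun c _ _ => h0 _
        intro c hc
        rw [Finset.mem_image] at hc
        obtain ⟨c₀, hc₀, rfl⟩ := hc
        refine Finset.mem_union_right _ (Finset.mem_biUnion.mpr ⟨c₀, hc₀, Finset.mem_image.mpr ⟨μ, Finset.mem_univ _, rfl⟩⟩)

omit [Fintype n] [DecidableEq n] [Nonempty n] in
/-- `S ⊆ S″`. [folklore] -/
theorem sum_prof_le_shift {prof : Site d → ℝ} (h0 : ∀ v, 0 ≤ prof v) (S : Finset (Site d)) (y : Site d) :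
    ∑ c ∈ S, prof (y - c) ≤ ∑ c ∈ S ∪ S.biUnion (fun c => Finset.univ.image fun ν : Fin d => c - e ν), prof (y - c) :=
  Finset.sum_le_sum_of_subset_of_nonneg Finset.subset_union_left fun _ _ _ => h0 _

omit [Fintype n] [DecidableEq n] [Nonempty n] in
/-- `|S″| ≤ (d+1)·|S|`. [folklore] -/
theorem card_shift_le (S : Finset (Site d)) :
    (S ∪ S.biUnion (fun c => Finset.univ.image fun ν : Fin d => c - e ν)).card ≤ (d + 1) * S.card := by
  classical
  calc (S ∪ S.biUnion (fun c => Finset.univ.image fun ν : Fin d => c - e ν)).card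
      ≤ S.card + (S.biUnion (fun c => Finset.univ.image fun ν : Fin d => c - e ν)).card := Finset.card_union_le _ _
    _ ≤ S.card + ∑ c ∈ S, (Finset.univ.image fun ν : Fin d => c - e ν).card := add_le_add le_rfl Finset.card_biUnion_le
    _ ≤ S.card + ∑ _c ∈ S, d := by
        refine add_le_add le_rfl (Finset.sum_le_sum fun c _ => ?_)
        exact Finset.card_image_le.trans (by simp)
    _ = (d + 1) * S.card := by rw [Finset.sum_const, smul_eq_mul]; ring

omit [Fintype n] [DecidableEq n] [Nonempty n] in
/-- The bondwise arithmetic of the defect majorant: with `0 ≤ p ≤ c`,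
`10240((ℓ+Λp)m + (ℓ+Λp)² + m(ℓ+Λp)) ≤ 10240(2mℓ + ℓ²) + 10240Λ(2m + 2ℓ + Λc)·p`. [folklore] -/
theorem defect_arith {m ℓ Λ p c : ℝ} (hp : 0 ≤ p) (hpc : p ≤ c) :
    10240 * ((ℓ + Λ * p) * m + (ℓ + Λ * p) * (ℓ + Λ * p) + m * (ℓ + Λ * p))
      ≤ 10240 * (2 * m * ℓ + ℓ ^ 2) + 10240 * Λ * (2 * m + 2 * ℓ + Λ * c) * p := by
  have eP : Λ ^ 2 * (p * p) ≤ Λ ^ 2 * (c * p) := mul_le_mul_of_nonneg_left (mul_le_mul_of_nonneg_right hpc hp) (sq_nonneg _)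
  nlinarith [eP]

/-! ## §2 The END at one top bond, modulo the profile letter -/

/-- **THE LINEARISED AVERAGE OF THE RELATIVE FIELD OF A GAUGED TWO-TIER DATUM, ON THE FIBRE.**  Setting: Π-C's tower class at `W` (period `L^{j+1}·N`,
`LevelSmall d L (j+1) x`, `SmallField W x`, `curvSum ≤ (2∕3)L`); `X₀` skew periodic of global sup `s₀` in the σ-regime with the fibre equation; the varied
configuration `W·e^{X₀}` in the multi-level class with radius `x′` (`LevelSmall d L j x′`); gauge data `(λ, B)` obeying `GaugedTwoTierData` with a GLOBAL sup `sB` of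
`B` in the σ-regime, tiers `m ℓ Λ ≥ 0` at `(z,κ)` with `2(3+12d)L^{j+1}m ≤ 1∕8192` and the σ-line for `m`; a profile `0 ≤ prof ≤ 1`; and the PROFILE LETTER
`hlin` of the linearised average at `(z,κ)` (γ4″).  Then
`‖dirIter L (j+1) W X₀ z κ‖ ≤ C₂(Mm)² + 10240(4(3+12d)Mm·q + q²) + Aσ·M·10240(2mℓ + ℓ²) + Bβ·((d+1)|S|)·10240Λ(2m + 2ℓ + Λ(d+1)|S|)`,
`q := ℓ + Λ|S|`, `M = L^{j+1}`. [folklore] -/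
theorem norm_dirIter_le_of_gaugedTwoTierData {L N j : ℕ} [NeZero N] (hL : 2 ≤ L) {W : Site d → Fin d → (Matrix n n ℂ)ˣ} {x : ℝ}
    (hWu : IsUnitaryCfg W) (hWP : IsPeriodicCfg W ((L ^ (j + 1) * N : ℕ) : ℤ)) (hx : 0 ≤ x) (hsm : LevelSmall d L (j + 1) x)
    (hWx : SmallField W x) (hA : curvSum d L (j + 1) x ≤ 2 / 3 * L)
    {X₀ : Site d → Fin d → Matrix n n ℂ} (hX₀s : IsSkewDir X₀) (hX₀P : IsPeriodicDir X₀ ((L ^ (j + 1) * N : ℕ) : ℤ))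
    {s₀ : ℝ} (hs₀ : 0 ≤ s₀) (hX₀ : ∀ (y : Site d) (μ : Fin d), ‖X₀ y μ‖ ≤ s₀) (hσ₀ : 4 * (3 + 12 * (d : ℝ)) ^ 2 * (L : ℝ) ^ (j + 1) * s₀ ≤ rho0 d L ^ 2)
    (hfib : cavgIter L (j + 1) (vary W X₀ 1) = cavgIter L (j + 1) W)
    {x' : ℝ} (hx' : 0 ≤ x') (hsm' : LevelSmall d L j x') (hAx' : SmallField (vary W X₀ 1) x')
    {prof : Site d → ℝ} (hp0 : ∀ v, 0 ≤ prof v) (hp1 : ∀ v, prof v ≤ 1)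
    {S : Site d → Fin d → Finset (Site d)} {lam : Site d → Matrix n n ℂ} {B : Site d → Fin d → Matrix n n ℂ} {m ℓ Λ : Site d → Fin d → ℝ}
    (hD : GaugedTwoTierData L N (j + 1) W X₀ prof S lam B m ℓ Λ)
    {sB : ℝ} (hsB : 0 ≤ sB) (hB : ∀ (y : Site d) (μ : Fin d), ‖B y μ‖ ≤ sB) (hσB : 4 * (3 + 12 * (d : ℝ)) ^ 2 * (L : ℝ) ^ (j + 1) * sB ≤ rho0 d L ^ 2)
    (z : Site d) (κ : Fin d) (hm : 0 ≤ m z κ) (hℓ : 0 ≤ ℓ z κ) (hΛ : 0 ≤ Λ z κ)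
    (hσm : 4 * (3 + 12 * (d : ℝ)) ^ 2 * (L : ℝ) ^ (j + 1) * m z κ ≤ rho0 d L ^ 2) (hm' : 2 * (3 + 12 * (d : ℝ)) * (L : ℝ) ^ (j + 1) * m z κ ≤ 1 / 8192)
    {Aσ Bβ : ℝ} (hBβ : 0 ≤ Bβ)
    (hlin : ∀ (Y : Site d → Fin d → Matrix n n ℂ) (S' : Finset (Site d)) (σ β : ℝ), IsSkewDir Y →
      IsPeriodicDir Y ((L ^ (j + 1) * N : ℕ) : ℤ) → 0 ≤ σ → 0 ≤ β →
      (∀ (y : Site d) (μ : Fin d), InBox (loK L (j + 1) z) (bondHiK L (j + 1) z κ) y → InBox (loK L (j + 1) z) (bondHiK L (j + 1) z κ) (y + e μ) →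
        ‖Y y μ‖ ≤ σ + β * ∑ c ∈ S', prof (y - c)) →
      ‖dirIter L (j + 1) W Y z κ‖ ≤ Aσ * (L : ℝ) ^ (j + 1) * σ + Bβ * S'.card * β) :
    ‖dirIter L (j + 1) W X₀ z κ‖
      ≤ 4 * (3 + 12 * (d : ℝ)) ^ 3 / rho0 d L ^ 2 * ((L : ℝ) ^ (j + 1) * m z κ) ^ 2
        + 10240 * (4 * (3 + 12 * (d : ℝ)) * (L : ℝ) ^ (j + 1) * m z κ * (ℓ z κ + Λ z κ * (S z κ).card) + (ℓ z κ + Λ z κ * (S z κ).card) ^ 2)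
        + Aσ * (L : ℝ) ^ (j + 1) * (10240 * (2 * m z κ * ℓ z κ + ℓ z κ ^ 2))
        + Bβ * ((d + 1) * (S z κ).card) * (10240 * Λ z κ * (2 * m z κ + 2 * ℓ z κ + Λ z κ * ((d + 1) * (S z κ).card))) := by
  classical
  have hL1 : 1 ≤ L := by omega
  set M : ℝ := (L : ℝ) ^ (j + 1) with hM
  set S'' : Finset (Site d) := S z κ ∪ (S z κ).biUnion (fun c => Finset.univ.image fun ν : Fin d => c - e ν) with hS''
  set P'' : Site d → ℝ := fun y => ∑ c ∈ S'', prof (y - c) with hP''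
  set q : ℝ := ℓ z κ + Λ z κ * (S z κ).card with hq
  have hcard'' : (S''.card : ℝ) ≤ (d + 1) * (S z κ).card := by exact_mod_cast card_shift_le (S z κ)
  have hP''0 : ∀ y, 0 ≤ P'' y := fun y => Finset.sum_nonneg fun c _ => hp0 _
  have hP''c : ∀ y, P'' y ≤ S''.card := fun y => sum_prof_le_card hp1 S'' y
  -- the companion configuration: `vary W B 1 = (vary W X₀ 1)^{u⁻¹}`, so it inherits the class radius `x′`
  have hu : ∀ y, expGauge lam 1 y ∈ unitaryUnits (Matrix n n ℂ) := expGauge_one_mem_unitaryUnits hD.lam_skew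
  have hZ : vary W B 1 = gaugeAct (fun y => (expGauge lam 1 y)⁻¹) (vary W X₀ 1) := by rw [hD.gauge_eq, gaugeAct_inv_gaugeAct]
  have hZx' : SmallField (vary W B 1) x' := by
    rw [hZ]; exact smallField_gaugeAct (fun y => (unitaryUnits _).inv_mem (hu y)) hAx'
  -- (1) γ-top on the fibre
  have h1 := norm_dirIter_sub_dirIter_defect_le_of_fibre hL hWu hWP hx hsm hWx hA hX₀s hX₀P hs₀ hX₀ hσ₀ hD.lam_skew hD.lam_small hD.lam_per
    hD.B_skew hD.B_per hsB hB hσB hD.gauge_eq hx' hsm' hZx' hfib z κ hm (hD.dom_B z κ) hσm hm'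
  -- the corner charges
  obtain ⟨hc0, hc1⟩ := corner_inBox (d := d) hL1 (j + 1) z κ
  have hΛm : ‖lam (((L : ℤ) ^ (j + 1)) • z)‖ ≤ q := by
    refine (hD.dom_lam z κ _ hc0).trans ?_
    rw [hq]; exact add_le_add le_rfl (mul_le_mul_of_nonneg_left (sum_prof_le_card hp1 _ _) hΛ)
  have hΛp : ‖lam (((L : ℤ) ^ (j + 1)) • (z + e κ))‖ ≤ q := by
    refine (hD.dom_lam z κ _ hc1).trans ?_
    rw [hq]; exact add_le_add le_rfl (mul_le_mul_of_nonneg_left (sum_prof_le_card hp1 _ _) hΛ)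
  have hq0 : 0 ≤ q := by rw [hq]; positivity
  -- (2) the defect on the box
  set Q : Site d → Fin d → Matrix n n ℂ := fun y μ => X₀ y μ - (gaugeDir W lam y μ + B y μ) with hQ
  have hQs : IsSkewDir Q := fun y μ => by
    simp only [hQ]
    exact (skewAdjoint _).sub_mem (hX₀s y μ) ((skewAdjoint _).add_mem (gaugeDir_skew hWu hD.lam_skew y μ) (hD.B_skew y μ))
  have hQP : IsPeriodicDir Q ((L ^ (j + 1) * N : ℕ) : ℤ) := by
    intro y i μ
    simp only [hQ, hX₀P y i μ, hD.B_per y i μ, isPeriodicDir_gaugeDir hWP hD.lam_per y i μ]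
  have hlog2 : ∀ y μ, ‖X₀ y μ‖ < Real.log 2 := fun y μ => by
    have := NE3QuadRemainderGauged.two_mul_sup_lt_log_two (d := d) (K := j + 1) hL hs₀ hσ₀
    have h3 : (1 : ℝ) ≤ 2 * (3 + 12 * (d : ℝ)) * (L : ℝ) ^ (j + 1) := by
      have hd0 : (0:ℝ) ≤ d := Nat.cast_nonneg d
      have hLk : (1:ℝ) ≤ (L:ℝ) ^ (j + 1) := one_le_pow₀ (by exact_mod_cast hL1)
      nlinarith
    have h4 : s₀ ≤ 2 * (3 + 12 * (d : ℝ)) * (L : ℝ) ^ (j + 1) * s₀ := by nlinarith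
    exact (hX₀ y μ).trans_lt (h4.trans_lt this)
  set σQ : ℝ := 10240 * (2 * m z κ * ℓ z κ + ℓ z κ ^ 2) with hσQ
  set βQ : ℝ := 10240 * Λ z κ * (2 * m z κ + 2 * ℓ z κ + Λ z κ * S''.card) with hβQ
  have hσQ0 : 0 ≤ σQ := by rw [hσQ]; positivity
  have hβQ0 : 0 ≤ βQ := by rw [hβQ]; positivity
  have hQdom : ∀ (y : Site d) (μ : Fin d), InBox (loK L (j + 1) z) (bondHiK L (j + 1) z κ) y →
      InBox (loK L (j + 1) z) (bondHiK L (j + 1) z κ) (y + e μ) → ‖Q y μ‖ ≤ σQ + βQ * P'' y := by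
    intro y μ hy hyμ
    have hBy : ‖B y μ‖ ≤ m z κ := hD.dom_B z κ y μ hy hyμ
    have hly : ‖lam y‖ ≤ ℓ z κ + Λ z κ * P'' y :=
      (hD.dom_lam z κ y hy).trans (add_le_add le_rfl (mul_le_mul_of_nonneg_left (sum_prof_le_shift hp0 _ _) hΛ))
    have hly' : ‖lam (y + e μ)‖ ≤ ℓ z κ + Λ z κ * P'' y :=
      (hD.dom_lam z κ (y + e μ) hyμ).trans (add_le_add le_rfl (mul_le_mul_of_nonneg_left (sum_prof_shift_le hp0 _ _ _) hΛ))
    have hQy := norm_gaugeDefect_le hWu hD.gauge_eq y μ (hlog2 y μ) (hD.lam_small y) (hD.lam_small (y + e μ)) (hD.B_small y μ)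
    -- make the profile sum an opaque real `p`
    obtain ⟨p, hp⟩ : ∃ p : ℝ, P'' y = p := ⟨_, rfl⟩
    rw [hp] at hly hly' ⊢
    have hPy0 : 0 ≤ p := hp ▸ hP''0 y
    have hPyc : p ≤ S''.card := hp ▸ hP''c y
    have hl0' := norm_nonneg (lam (y + e μ))
    have hB0 := norm_nonneg (B y μ)
    have hq1 : 0 ≤ ℓ z κ + Λ z κ * p := by positivity
    -- products
    have e1 : ‖lam y‖ * ‖B y μ‖ ≤ (ℓ z κ + Λ z κ * p) * m z κ := mul_le_mul hly hBy hB0 hq1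
    have e3 : ‖B y μ‖ * ‖lam (y + e μ)‖ ≤ m z κ * (ℓ z κ + Λ z κ * p) := mul_le_mul hBy hly' hl0' hm
    have e2 : ‖lam y‖ * ‖lam (y + e μ)‖ ≤ (ℓ z κ + Λ z κ * p) * (ℓ z κ + Λ z κ * p) := mul_le_mul hly hly' hl0' hq1
    have hstep : 10240 * (‖lam y‖ * ‖B y μ‖ + ‖lam y‖ * ‖lam (y + e μ)‖ + ‖B y μ‖ * ‖lam (y + e μ)‖)
        ≤ 10240 * ((ℓ z κ + Λ z κ * p) * m z κ + (ℓ z κ + Λ z κ * p) * (ℓ z κ + Λ z κ * p) + m z κ * (ℓ z κ + Λ z κ * p)) :=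
      mul_le_mul_of_nonneg_left (add_le_add (add_le_add e1 e2) e3) (by norm_num)
    have hfin := defect_arith (m := m z κ) (ℓ := ℓ z κ) (Λ := Λ z κ) hPy0 hPyc
    rw [hσQ, hβQ]
    exact hQy.trans (hstep.trans hfin)
  -- (3) the profile letter on the defect
  have h3 := hlin Q S'' σQ βQ hQs hQP hσQ0 hβQ0 hQdom
  -- (4) assemble
  have hsplit : ‖dirIter L (j + 1) W X₀ z κ‖ ≤ ‖dirIter L (j + 1) W X₀ z κ - dirIter L (j + 1) W Q z κ‖ + ‖dirIter L (j + 1) W Q z κ‖ :=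
    norm_le_norm_sub_add _ _
  have hMm0 : 0 ≤ M * m z κ := by positivity
  have hK0 : (0 : ℝ) ≤ 2 * (3 + 12 * (d : ℝ)) := by have : (0:ℝ) ≤ d := Nat.cast_nonneg d; linarith
  have hterm1 : 10240 * (2 * (3 + 12 * (d : ℝ)) * M * m z κ * (‖lam (((L : ℤ) ^ (j + 1)) • z)‖ + ‖lam (((L : ℤ) ^ (j + 1)) • (z + e κ))‖)
        + ‖lam (((L : ℤ) ^ (j + 1)) • z)‖ * ‖lam (((L : ℤ) ^ (j + 1)) • (z + e κ))‖)
      ≤ 10240 * (4 * (3 + 12 * (d : ℝ)) * M * m z κ * q + q ^ 2) := by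
    have ha := norm_nonneg (lam (((L : ℤ) ^ (j + 1)) • z))
    have hb := norm_nonneg (lam (((L : ℤ) ^ (j + 1)) • (z + e κ)))
    have e1 : ‖lam (((L : ℤ) ^ (j + 1)) • z)‖ * ‖lam (((L : ℤ) ^ (j + 1)) • (z + e κ))‖ ≤ q * q := mul_le_mul hΛm hΛp hb hq0
    have e2 : 2 * (3 + 12 * (d : ℝ)) * M * m z κ * (‖lam (((L : ℤ) ^ (j + 1)) • z)‖ + ‖lam (((L : ℤ) ^ (j + 1)) • (z + e κ))‖)
        ≤ 2 * (3 + 12 * (d : ℝ)) * M * m z κ * (q + q) := mul_le_mul_of_nonneg_left (add_le_add hΛm hΛp) (by positivity)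
    linarith only [e1, e2]
  have hterm3 : Bβ * S''.card * βQ ≤ Bβ * ((d + 1) * (S z κ).card) * (10240 * Λ z κ * (2 * m z κ + 2 * ℓ z κ + Λ z κ * ((d + 1) * (S z κ).card))) := by
    have hβQ' : βQ ≤ 10240 * Λ z κ * (2 * m z κ + 2 * ℓ z κ + Λ z κ * ((d + 1) * (S z κ).card)) := by
      rw [hβQ]; gcongr
    have hc0 : (0 : ℝ) ≤ S''.card := Nat.cast_nonneg _
    calc Bβ * S''.card * βQ ≤ Bβ * ((d + 1) * (S z κ).card) * βQ := by gcongr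
      _ ≤ _ := mul_le_mul_of_nonneg_left hβQ' (by positivity)
  calc ‖dirIter L (j + 1) W X₀ z κ‖
      ≤ ‖dirIter L (j + 1) W X₀ z κ - dirIter L (j + 1) W Q z κ‖ + ‖dirIter L (j + 1) W Q z κ‖ := hsplit
    _ ≤ (4 * (3 + 12 * (d : ℝ)) ^ 3 / rho0 d L ^ 2 * (M * m z κ) ^ 2
          + 10240 * (2 * (3 + 12 * (d : ℝ)) * M * m z κ * (‖lam (((L : ℤ) ^ (j + 1)) • z)‖ + ‖lam (((L : ℤ) ^ (j + 1)) • (z + e κ))‖)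
            + ‖lam (((L : ℤ) ^ (j + 1)) • z)‖ * ‖lam (((L : ℤ) ^ (j + 1)) • (z + e κ))‖))
        + (Aσ * M * σQ + Bβ * S''.card * βQ) := add_le_add h1 h3
    _ ≤ _ := by linarith only [hterm1, hterm3]

end

end Summit.QuantumFields.BalabanUV.T4Continuum.NE3QuadRemainderGaugedEnd
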